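import Mathlib.Analysis.SpecialFunctions.Pow.Deriv
import Mathlib.Analysis.SpecialFunctions.ExpDeriv
import Mathlib.Analysis.Calculus.Deriv.MeanValue
import HarnessLib

/-!
# The differential inequality `E' ≤ −c E^{1+α} + C₁ E` (Nash's argument)

J. Nash, *Continuity of solutions of parabolic and elliptic equations*, Amer. J. Math. 80 (1958),
part II: the `L²`-norm `E(t) = ‖u(t)‖₂²` of a solution of a parabolic equation satisfies, by the
energy identity and Nash's inequality, a differential inequality `E' ≤ −c E^{1+α} + C₁ E`
(`α = 2/n`), which forces the bound `E(t) ≤ e^{C₁(t−s)} (α c (t − s))^{-1/α}` INDEPENDENT of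
`E(s)` — the source of the `L¹ → L²` (and by duality `L¹ → L^∞`, `‖P‖ ≤ C τ^{-n/2}`) smoothing of
heat semigroups. This file proves the elementary real-variable comparison statements:

* `nash_ode_bound` — forward form on `[s, t]`: if `E > 0` is continuous on `[s, t]` with
  derivatives `E'(r)` within `[s, t]` satisfying `E'(r) ≤ −c E(r)^{1+α} + C₁ E(r)`, then
  `E(t) ≤ exp(C₁ (t − s)) · (α c (t − s))^{-1/α}`;
* `nash_ode_bound_backward` — backward form: `E'(r) ≥ c E(r)^{1+α} − C₁ E(r)` gives the same
  bound for `E(s)`.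

Proof: `G(r) = e^{−C₁(r−s)} E(r)` has `G' ≤ −c G^{1+α}`, so `(G^{−α})' ≥ α c` and
`G(t)^{−α} ≥ α c (t − s)`. Everything is proved; no definitions, no named facts.

## References

* J. Nash, *Continuity of solutions of parabolic and elliptic equations*, Amer. J. Math. 80
  (1958), 931–954, part II.
* E. B. Davies, *Heat kernels and spectral theory*, Cambridge Tracts in Math. 92 (1989), §2.4
  (Nash's argument).
-/

noncomputable section

open Set Filter Topology

namespace Literature.Analysis.ODE

/-- **Nash's differential inequality, forward form.** Let `s < t`, `c > 0`, `α > 0`, `C₁ ≥ 0`,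
and let `E` be continuous and positive on `[s, t]` with, at every `r ∈ [s, t]`, a derivative
`E' r` within `[s, t]` such that `E' r ≤ −c (E r)^{1+α} + C₁ E r`. Then
`E t ≤ exp(C₁ (t − s)) · (α c (t − s))^{−1/α}` — a bound independent of `E s`. [folklore] -/
theorem nash_ode_bound {s t c α C₁ : ℝ} (hst : s < t) (hc : 0 < c) (hα : 0 < α) (hC₁ : 0 ≤ C₁)
    {E E' : ℝ → ℝ} (hEc : ContinuousOn E (Icc s t)) (hEpos : ∀ r ∈ Icc s t, 0 < E r)
    (hEd : ∀ r ∈ Icc s t, HasDerivWithinAt E (E' r) (Icc s t) r)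
    (hineq : ∀ r ∈ Icc s t, E' r ≤ -c * E r ^ (1 + α) + C₁ * E r) :
    E t ≤ Real.exp (C₁ * (t - s)) * (α * c * (t - s)) ^ (-(1 / α)) := by
  -- `G r = exp(−C₁ (r − s)) E r > 0`
  set G : ℝ → ℝ := fun r ↦ Real.exp (-(C₁ * (r - s))) * E r with hG
  have hGpos : ∀ r ∈ Icc s t, 0 < G r := fun r hr ↦ mul_pos (Real.exp_pos _) (hEpos r hr)
  have hGc : ContinuousOn G (Icc s t) := by
    refine ContinuousOn.mul (Continuous.continuousOn ?_) hEc
    fun_prop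
  -- derivative of `G` within `[s, t]`
  have hexpd : ∀ r, HasDerivWithinAt (fun r ↦ Real.exp (-(C₁ * (r - s))))
      (Real.exp (-(C₁ * (r - s))) * (-C₁)) (Icc s t) r := by
    intro r
    have h1 : HasDerivWithinAt (fun r : ℝ ↦ -(C₁ * (r - s))) (-C₁) (Icc s t) r := by
      have h0 := (((hasDerivWithinAt_id r (Icc s t)).sub_const s).const_mul C₁).neg
      simp only [mul_one] at h0
      exact h0
    exact h1.exp
  have hGd : ∀ r ∈ Icc s t, HasDerivWithinAt G
      (Real.exp (-(C₁ * (r - s))) * (-C₁) * E r + Real.exp (-(C₁ * (r - s))) * E' r) (Icc s t) r :=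
    fun r hr ↦ (hexpd r).mul (hEd r hr)
  -- `G' ≤ −c G^{1+α}`
  have hGineq : ∀ r ∈ Icc s t,
      Real.exp (-(C₁ * (r - s))) * (-C₁) * E r + Real.exp (-(C₁ * (r - s))) * E' r ≤
        -c * G r ^ (1 + α) := by
    intro r hr
    have hE0 : 0 ≤ E r := (hEpos r hr).le
    have hexp0 : 0 < Real.exp (-(C₁ * (r - s))) := Real.exp_pos _
    -- `exp(−C₁(r−s)) E^{1+α} ≥ G^{1+α}` since `exp(−C₁(r−s)) ≤ 1`... precisely:
    -- `G^{1+α} = exp(−C₁(r−s))^{1+α} E^{1+α} ≤ exp(−C₁(r−s)) E^{1+α}`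
    have hle1 : Real.exp (-(C₁ * (r - s))) ≤ 1 := by
      rw [Real.exp_le_one_iff, neg_nonpos]
      exact mul_nonneg hC₁ (by linarith [hr.1])
    have hpow : G r ^ (1 + α) ≤ Real.exp (-(C₁ * (r - s))) * E r ^ (1 + α) := by
      rw [hG]
      simp only
      rw [Real.mul_rpow hexp0.le hE0]
      refine mul_le_mul_of_nonneg_right ?_ (Real.rpow_nonneg hE0 _)
      calc Real.exp (-(C₁ * (r - s))) ^ (1 + α)
          ≤ Real.exp (-(C₁ * (r - s))) ^ (1 : ℝ) :=
            Real.rpow_le_rpow_of_exponent_ge hexp0 hle1 (by linarith)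
        _ = Real.exp (-(C₁ * (r - s))) := Real.rpow_one _
    have key : Real.exp (-(C₁ * (r - s))) * E' r ≤
        Real.exp (-(C₁ * (r - s))) * (-c * E r ^ (1 + α) + C₁ * E r) :=
      mul_le_mul_of_nonneg_left (hineq r hr) hexp0.le
    nlinarith [key, hpow, hc]
  -- `φ = G^{−α}` has `φ' ≥ α c`
  set φ : ℝ → ℝ := fun r ↦ G r ^ (-α) with hφ
  have hφd : ∀ r ∈ Icc s t, HasDerivWithinAt φ
      ((Real.exp (-(C₁ * (r - s))) * (-C₁) * E r + Real.exp (-(C₁ * (r - s))) * E' r) * (-α) *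
        G r ^ (-α - 1)) (Icc s t) r :=
    fun r hr ↦ (hGd r hr).rpow_const (Or.inl (hGpos r hr).ne')
  have hφ'ge : ∀ r ∈ Icc s t, α * c ≤
      (Real.exp (-(C₁ * (r - s))) * (-C₁) * E r + Real.exp (-(C₁ * (r - s))) * E' r) * (-α) *
        G r ^ (-α - 1) := by
    intro r hr
    have hG0 := hGpos r hr
    have h1 : α * c * (G r ^ (1 + α) * G r ^ (-α - 1)) ≤
        (-(Real.exp (-(C₁ * (r - s))) * (-C₁) * E r + Real.exp (-(C₁ * (r - s))) * E' r)) * α *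
          G r ^ (-α - 1) := by
      have := hGineq r hr
      have hpos : 0 ≤ α * G r ^ (-α - 1) := mul_nonneg hα.le (Real.rpow_nonneg hG0.le _)
      nlinarith [mul_le_mul_of_nonneg_right (neg_le_neg this) hpos]
    have h2 : G r ^ (1 + α) * G r ^ (-α - 1) = 1 := by
      rw [← Real.rpow_add hG0, show (1 + α + (-α - 1) : ℝ) = 0 by ring, Real.rpow_zero]
    rw [h2, mul_one] at h1
    linarith
  -- monotonicity of `φ r − α c r` on `[s, t]`
  have hψc : ContinuousOn (fun r ↦ φ r - α * c * r) (Icc s t) := by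
    refine ContinuousOn.sub (fun r hr ↦ ?_) (by fun_prop)
    exact ((hGc r hr).rpow_const (Or.inl (hGpos r hr).ne'))
  have hmono : MonotoneOn (fun r ↦ φ r - α * c * r) (Icc s t) := by
    refine monotoneOn_of_hasDerivWithinAt_nonneg (convex_Icc s t) hψc
      (f' := fun r ↦ (Real.exp (-(C₁ * (r - s))) * (-C₁) * E r +
        Real.exp (-(C₁ * (r - s))) * E' r) * (-α) * G r ^ (-α - 1) - α * c) ?_ ?_
    · intro r hr
      rw [interior_Icc] at hr ⊢
      have hr' : r ∈ Icc s t := Ioo_subset_Icc_self hr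
      exact ((hφd r hr').mono Ioo_subset_Icc_self).sub
        ((hasDerivWithinAt_id r _).const_mul (α * c) |>.congr_deriv (by ring))
    · intro r hr
      rw [interior_Icc] at hr
      linarith [hφ'ge r (Ioo_subset_Icc_self hr)]
  have hst' := hmono (left_mem_Icc.2 hst.le) (right_mem_Icc.2 hst.le) hst.le
  simp only at hst'
  have hφs : 0 < φ s := Real.rpow_pos_of_pos (hGpos s (left_mem_Icc.2 hst.le)) _
  have hφt : α * c * (t - s) ≤ φ t := by nlinarith
  -- invert: `G t ≤ (α c (t − s))^{−1/α}`
  have hGt0 := hGpos t (right_mem_Icc.2 hst.le)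
  have hact : 0 < α * c * (t - s) := by positivity
  have hGt : G t ≤ (α * c * (t - s)) ^ (-(1 / α)) := by
    have h1 : G t = (φ t) ^ (-(1 / α)) := by
      rw [hφ]
      simp only
      rw [← Real.rpow_mul hGt0.le]
      have : -α * -(1 / α) = 1 := by field_simp
      rw [this, Real.rpow_one]
    rw [h1]
    exact Real.rpow_le_rpow_of_nonpos hact hφt (by
      rw [neg_nonpos]; positivity)
  -- back to `E`
  have hE : E t = Real.exp (C₁ * (t - s)) * G t := by
    rw [hG]
    simp only
    rw [← mul_assoc, ← Real.exp_add]
    simp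
  rw [hE]
  exact mul_le_mul_of_nonneg_left hGt (Real.exp_pos _).le

/-- **Nash's differential inequality, backward form** (for conjugate / adjoint flows): if `E > 0`
is continuous on `[s, t]` with derivatives `E' r` within `[s, t]` satisfying
`E' r ≥ c (E r)^{1+α} − C₁ E r`, then `E s ≤ exp(C₁ (t − s)) · (α c (t − s))^{−1/α}`
(`nash_ode_bound` for `r ↦ E (t + s − r)`). [folklore] -/
theorem nash_ode_bound_backward {s t c α C₁ : ℝ} (hst : s < t) (hc : 0 < c) (hα : 0 < α)
    (hC₁ : 0 ≤ C₁) {E E' : ℝ → ℝ} (hEc : ContinuousOn E (Icc s t)) (hEpos : ∀ r ∈ Icc s t, 0 < E r)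
    (hEd : ∀ r ∈ Icc s t, HasDerivWithinAt E (E' r) (Icc s t) r)
    (hineq : ∀ r ∈ Icc s t, c * E r ^ (1 + α) - C₁ * E r ≤ E' r) :
    E s ≤ Real.exp (C₁ * (t - s)) * (α * c * (t - s)) ^ (-(1 / α)) := by
  -- reflect time: `F r = E (t + s − r)`
  set F : ℝ → ℝ := fun r ↦ E (t + s - r) with hF
  have hmaps : MapsTo (fun r : ℝ ↦ t + s - r) (Icc s t) (Icc s t) := fun r hr ↦
    ⟨by linarith [hr.2], by linarith [hr.1]⟩
  have hrefl : ∀ r ∈ Icc s t, t + s - r ∈ Icc s t := fun r hr ↦ hmaps hr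
  have hFc : ContinuousOn F (Icc s t) := hEc.comp (by fun_prop) hmaps
  have hFpos : ∀ r ∈ Icc s t, 0 < F r := fun r hr ↦ hEpos _ (hrefl r hr)
  have hFd : ∀ r ∈ Icc s t, HasDerivWithinAt F (-E' (t + s - r)) (Icc s t) r := by
    intro r hr
    have h1 : HasDerivWithinAt (fun r : ℝ ↦ t + s - r) (-1) (Icc s t) r := by
      have h0 := (hasDerivWithinAt_const r (Icc s t) (t + s)).sub (hasDerivWithinAt_id r _)
      simp only [zero_sub] at h0
      exact h0
    have h2 := (hEd _ (hrefl r hr)).comp r h1 hmaps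
    have h3 : HasDerivWithinAt (fun r ↦ E (t + s - r)) (E' (t + s - r) * -1) (Icc s t) r := h2
    simpa using h3
  have hFineq : ∀ r ∈ Icc s t, -E' (t + s - r) ≤ -c * F r ^ (1 + α) + C₁ * F r := by
    intro r hr
    have := hineq _ (hrefl r hr)
    simp only [hF]
    linarith
  have key := nash_ode_bound hst hc hα hC₁ hFc hFpos hFd hFineq
  simpa [hF] using key

end Literature.Analysis.ODE

end
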